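import Mathlib
import Summits.NavierStokesRegularity.NavierStokesRegularity.Theorems.TaoLadderRungTwoFlatCoreHopFlat
import HarnessLib

/-!
# CORE ROW 56 (part 1 of 3) — theory-1 g44's cure of TRAP #14 (the core row gain in `HopTube.core_hop_flat_closed`): L-56a, the section-time step in any window-REGULAR gauge, site form
  (helper for the K_A♭ parent item stmt-NavierStokesRegularity-22987 `FlatGapCertificatesV2`, children 1A/2A of route
  TaoLadderRungTwoFlat; cell harvest/h2-tao-ladder, theory-1 g44, memo numT56/CORE-ROW-56 / LADDER §56)

PROVENANCE (p1 g23): theory-1 g44's image of record numT56/CoreRow56.lean sha16 0faf4d271a46ab3c (747 l., farm `lean check`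
rc 0 · 0 sorry · 0 warnings · axioms propext/Classical.choice/Quot.sound), landed with declarations BYTE-IDENTICAL in THREE
modules (400-line lint): part 1 `…CoreRowGauge` (L-56a: `QuadPolar.gauge_abs_accel_le_of_sup`, `gauge_abs_taylor_le_of_sup`,
`MirrorPulse.gauge_abs_quadTermOn_sub_time_le_of_sup`, `landing_at_section_time_gauge`), part 2 `…CoreRowAnchor` (L-56c:
`MirrorPulse.anchored_landing_site`, `core_phase_landing_flat_anchored`), part 3 `…CoreRowSharp` (L-56b:
`HopTube.isWindowRegular_geomGauge_shift`, `geomGauge_pred_le_headGauge`, `core_landing_at_section_time_sharp`,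
`core_hop_flat_closed_sharp`). This is part 1. The image's module docstring follows verbatim.

# numT56 (theory-1 g44, cell harvest/h2-tao-ladder): the CORE ROW of the flat tube WITHOUT the two gain artefacts
  (trap-candidate #14 "core row gain" in `HopTube.core_hop_flat_closed`; cures L-56a/b/c; helper material for the K_A♭
  parent item stmt-NavierStokesRegularity-22987 `FlatGapCertificatesV2`, children 1A/2A of route TaoLadderRungTwoFlat)

THE TRAP. The landed composition `HopTube.core_hop_flat_closed` (p1 g22) is a true theorem whose budget cannot be met
along a ladder with a non-growing tube: its `CoreClause (n+1)` costs `a·δ(n+1) ≥ η̄₁·(1 + M_ω/(ω₀A_*)) ≥ 2·η̄₁` with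
`η̄₁ ≥ D ≥ C_conv·ρ·B`, `C_conv = max(g, b^{K+1}) ≥ 4`, so the per-hop factor on the core datum is `≥ 2·C_conv·ρ ≥ 8ρ`
(`ρ ≈ 0.61` certified-scale float, E-T46-hop): two bookkeeping losses, each alone fatal —
(L1) GAUGE ROUND TRIP: the contraction-gauge landing (`core_phase_landing_flat`, leading term `ρB`) is converted to a
  UNIFORM head-gauge datum (`× C_conv`) only because `MirrorPulse.landing_at_section_time` is typed in the head gauge
  (window-ADMISSIBLE), and converted back in `core_landing_at_section_time` (losing nothing more);
(L2) ANCHOR READ-OFF: the anchor-scale mismatch is fed with the UNIFORM landing error `η̄₁/ω₀`, although at the anchor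
  site the corrected deviation vanishes EXACTLY (`anchorCoeff_spec`): the anchor datum is second order.

THE CURES (this file, kernel-checked against the tree):
* L-56a `QuadPolar.gauge_abs_accel_le_of_sup`, `gauge_abs_taylor_le_of_sup`, `MirrorPulse.gauge_abs_quadTermOn_sub_time_le_of_sup`,
  `MirrorPulse.landing_at_section_time_gauge` — the section-time step in ANY window-REGULAR gauge (mixed sup/gauge
  bounds replace admissibility), in SITE FORM (the leading term is the site's own landing datum); applied in the
  shifted contraction gauge `ω♯_m = geomGauge(m−1)` (`Λ = max(g,b)`) there is no conversion constant at all;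
* L-56c `MirrorPulse.anchored_landing_site`, `core_phase_landing_flat_anchored` — the phase landing with the extra
  ANCHOR clause `ω₀|X_{i₀,1}(τ) − κΦ_{i₀,1}(τ+h)| ≤ 12C_aB²‖T♭‖₁²g²M_w³` (pure second order);
* L-56b `HopTube.core_landing_at_section_time_sharp`, `HopTube.core_hop_flat_closed_sharp` — the re-composed core hop:
  budget `(E + S) + ((E_a + S)/ω₀/A_*)·M_ω ≤ a·δ(n+1)` with `E ≥ ρB + (1+q)Rem + 12C_aB²G` entering ONCE, `E_a = 12C_aB²G`
  and `S = O(C_aB² + C_aB·E)`: the coefficient of `B` is `ρ` — the certified contraction rate, undiluted.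

HONEST FRAMING: conditional estimates about MODEL-lattice solutions (Tao 2016 §4 vocabulary on `S♭`, `mirrorTable ε ε`,
m = 2); the anchored contraction (S2) and all bounds are HYPOTHESES; desk floats quoted above are UNSEALED; nothing
certified; no item closed; nothing about the Navier–Stokes equations.
-/

noncomputable section

-- the sub-problem namespace repeats the summit name by design (D-0017)
set_option linter.dupNamespace false

namespace Summit.NavierStokesRegularity.NavierStokesRegularity.Theorems

open Set Filter Literature.Analysis.FluidPDE Literature.Analysis.FluidPDE.TaoCascade QuadPolar
open scoped Topology


/-! ## L-56a, generic part: acceleration and Taylor bounds in a window-REGULAR gauge (mixed sup/gauge) -/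

namespace QuadPolar

variable {m : ℕ}

/-- **Mixed gauge bound on the acceleration of an exact solution** (window-REGULAR gauge, no admissibility): if
`|W| ≤ M` and `w|W| ≤ M_w` at all sites at time `t`, then `w_{i,n}|Lin_W(Q(W))_{i,n}(t)| ≤ 2‖α‖₁²M²Λ²M_w`.
[cite: Tao2016AveragedNS, §4 (4.8); folklore estimate; cell harvest/h2-tao-ladder numT56 L-56a] -/
theorem gauge_abs_accel_le_of_sup {𝕊 : Finset (ℤ × ℤ × ℤ)} (h𝕊 : IsNearestNeighbourSet 𝕊)
    (α : Fin m → Fin m → Fin m → ℤ × ℤ × ℤ → ℝ) {w : Fin m → ℤ → ℝ} {Λ : ℝ} (hw : IsWindowRegular w Λ)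
    {W : Fin m → ℤ → ℝ → ℝ} {M Mw t : ℝ} (hWb : ∀ j k, |W j k t| ≤ M) (hMw : 0 ≤ Mw)
    (hWg : ∀ j k, w j k * |W j k t| ≤ Mw) (i : Fin m) (n : ℤ) :
    w i n * |linTermOn 𝕊 0 α W (fun j k s => quadTermOn 𝕊 0 α W j k s) i n t| ≤
      2 * (tableAbsSum 𝕊 α) ^ 2 * M ^ 2 * Λ ^ 2 * Mw := by
  have hM : 0 ≤ M := (abs_nonneg _).trans (hWb i n)
  have hT : 0 ≤ tableAbsSum 𝕊 α := tableAbsSum_nonneg _ _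
  have hΛ : 0 ≤ Λ := by linarith [hw.2.1]
  have hQ : ∀ j k, w j k * |quadTermOn 𝕊 0 α W j k t| ≤ tableAbsSum 𝕊 α * M * Λ * Mw := fun j k =>
    gauge_abs_quadTermOn_le_of_sup h𝕊 α hw hWb hMw fun j' k' _ => hWg j' k'
  have hc : 0 ≤ tableAbsSum 𝕊 α * M * Λ * Mw := by positivity
  have h := gauge_abs_linTermOn_le_of_sup h𝕊 α hw (Ψ := W) (u := fun j k s => quadTermOn 𝕊 0 α W j k s)
    (t := t) hWb hc (i := i) (n := n) (fun j k _ => hQ j k)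
  calc w i n * |linTermOn 𝕊 0 α W (fun j k s => quadTermOn 𝕊 0 α W j k s) i n t|
      ≤ 2 * tableAbsSum 𝕊 α * M * Λ * (tableAbsSum 𝕊 α * M * Λ * Mw) := h
    _ = 2 * (tableAbsSum 𝕊 α) ^ 2 * M ^ 2 * Λ ^ 2 * Mw := by ring

/-- **Mixed gauge Taylor bound** (window-REGULAR gauge): with `|W| ≤ M` everywhere, `w|W| ≤ M_w` on `[T−1, T+1]` and
`|h| ≤ 1`, `w_{i,n}|W_{i,n}(T+h) − W_{i,n}(T) − h·Q(W)_{i,n}(T)| ≤ 2‖α‖₁²M²Λ²M_w·h²`.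
[cite: Tao2016AveragedNS, §4 (4.8); folklore; cell harvest/h2-tao-ladder numT56 L-56a] -/
theorem gauge_abs_taylor_le_of_sup {𝕊 : Finset (ℤ × ℤ × ℤ)} (h𝕊 : IsNearestNeighbourSet 𝕊)
    (α : Fin m → Fin m → Fin m → ℤ × ℤ × ℤ → ℝ) {w : Fin m → ℤ → ℝ} {Λ : ℝ} (hw : IsWindowRegular w Λ)
    {W : Fin m → ℤ → ℝ → ℝ} {M Mw T h : ℝ} (hMw : 0 ≤ Mw)
    (hW : ∀ i n t, HasDerivAt (W i n) (quadTermOn 𝕊 0 α W i n t) t) (hWb : ∀ j k t, |W j k t| ≤ M)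
    (hWg : ∀ j k, ∀ t ∈ Icc (T - 1) (T + 1), w j k * |W j k t| ≤ Mw) (hh : |h| ≤ 1) (i : Fin m) (n : ℤ) :
    w i n * |W i n (T + h) - W i n T - h * quadTermOn 𝕊 0 α W i n T| ≤
      2 * (tableAbsSum 𝕊 α) ^ 2 * M ^ 2 * Λ ^ 2 * Mw * h ^ 2 := by
  have hw0 : 0 < w i n := hw.1 i n
  set G : ℝ := 2 * (tableAbsSum 𝕊 α) ^ 2 * M ^ 2 * Λ ^ 2 * Mw with hG
  have hG0 : 0 ≤ G := by rw [hG]; positivity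
  have hQd : ∀ s, HasDerivAt (fun s => quadTermOn 𝕊 0 α W i n s)
      (linTermOn 𝕊 0 α W (fun j k s => quadTermOn 𝕊 0 α W j k s) i n s) s := fun s =>
    MirrorPulse.hasDerivAt_quadTermOn 𝕊 0 α (fun j k => hW j k s) i n
  have hlipQ : ∀ s ∈ Icc (T - |h|) (T + |h|),
      |quadTermOn 𝕊 0 α W i n s - quadTermOn 𝕊 0 α W i n T| ≤ G / w i n * |s - T| := by
    intro s hs
    have hsub : uIcc T s ⊆ Icc (T - 1) (T + 1) := by
      intro x hx
      rcases le_or_gt T s with hTs | hTs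
      · rw [uIcc_of_le hTs] at hx; exact ⟨by linarith [hx.1], by linarith [hx.2, hs.2]⟩
      · rw [uIcc_of_ge hTs.le] at hx; exact ⟨by linarith [hx.1, hs.1], by linarith [hx.2]⟩
    have hb : ∀ x ∈ uIcc T s,
        ‖linTermOn 𝕊 0 α W (fun j k s => quadTermOn 𝕊 0 α W j k s) i n x‖ ≤ G / w i n := by
      intro x hx
      rw [Real.norm_eq_abs, le_div_iff₀ hw0, mul_comm]
      exact gauge_abs_accel_le_of_sup h𝕊 α hw (fun j k => hWb j k x) hMw (fun j k => hWg j k x (hsub hx)) i n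
    have h := Convex.norm_image_sub_le_of_norm_hasDerivWithin_le (fun x _ => (hQd x).hasDerivWithinAt) hb
      (convex_uIcc T s) left_mem_uIcc right_mem_uIcc
    rw [Real.norm_eq_abs, Real.norm_eq_abs] at h
    exact h
  have ht := abs_taylor_two_le (f := W i n) (f' := fun s => quadTermOn 𝕊 0 α W i n s) (by positivity) (hW i n)
    hlipQ
  calc w i n * |W i n (T + h) - W i n T - h * quadTermOn 𝕊 0 α W i n T| ≤ w i n * (G / w i n * h ^ 2) :=
        mul_le_mul_of_nonneg_left ht hw0.le
    _ = G * h ^ 2 := by field_simp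

end QuadPolar

/-! ## L-56a, flat part: time-Lipschitz of `Q(Φ)` and the SECTION-TIME STEP in a window-regular gauge, site form -/

namespace MirrorPulse

/-- **Time-Lipschitz of `Q(Φ)` in a window-regular gauge** (mixed form): for a global solution `Φ` with `|Φ| ≤ M`,
`w|Φ| ≤ M_w` on `[τ−1, τ+1]` and `|h| ≤ 1`: `w_n|Q(Φ)_n(τ+h) − Q(Φ)_n(τ)| ≤ 2‖T♭‖₁²M²Λ²M_w·|h|`.
[cite: Tao2016AveragedNS, §4 (4.8); folklore; cell harvest/h2-tao-ladder numT56 L-56a] -/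
theorem gauge_abs_quadTermOn_sub_time_le_of_sup {ε : ℝ} {Φ : Fin 2 → ℤ → ℝ → ℝ} {w : Fin 2 → ℤ → ℝ}
    {Λ M Mw τ h : ℝ} (hΦ : IsGlobalSol ε Φ) (hw : IsWindowRegular w Λ) (hΦb : ∀ i n t, |Φ i n t| ≤ M)
    (hMw : 0 ≤ Mw) (hΦg : ∀ j k, ∀ t ∈ Icc (τ - 1) (τ + 1), w j k * |Φ j k t| ≤ Mw)
    (hh : |h| ≤ 1) (i : Fin 2) (n : ℤ) :
    w i n * |quadTermOn shiftSetFlat 0 (mirrorTable ε ε) Φ i n (τ + h)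
        - quadTermOn shiftSetFlat 0 (mirrorTable ε ε) Φ i n τ|
      ≤ 2 * (tableAbsSum shiftSetFlat (mirrorTable ε ε)) ^ 2 * M ^ 2 * Λ ^ 2 * Mw * |h| := by
  have hw0 : 0 < w i n := hw.1 i n
  have hQd : ∀ s, HasDerivAt (fun s => quadTermOn shiftSetFlat 0 (mirrorTable ε ε) Φ i n s)
      (linTermOn shiftSetFlat 0 (mirrorTable ε ε) Φ
        (fun j k s => quadTermOn shiftSetFlat 0 (mirrorTable ε ε) Φ j k s) i n s) s := fun s =>
    MirrorPulse.hasDerivAt_quadTermOn shiftSetFlat 0 (mirrorTable ε ε) (fun j k => hΦ j k s) i n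
  have hsub : uIcc τ (τ + h) ⊆ Icc (τ - 1) (τ + 1) := by
    intro x hx
    have h1 := (abs_le.mp hh).1
    have h2 := (abs_le.mp hh).2
    rcases le_or_gt τ (τ + h) with hτs | hτs
    · rw [uIcc_of_le hτs] at hx; exact ⟨by linarith [hx.1], by linarith [hx.2]⟩
    · rw [uIcc_of_ge hτs.le] at hx; exact ⟨by linarith [hx.1], by linarith [hx.2]⟩
  have hb : ∀ x ∈ uIcc τ (τ + h), ‖w i n * linTermOn shiftSetFlat 0 (mirrorTable ε ε) Φ
        (fun j k s => quadTermOn shiftSetFlat 0 (mirrorTable ε ε) Φ j k s) i n x‖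
      ≤ 2 * (tableAbsSum shiftSetFlat (mirrorTable ε ε)) ^ 2 * M ^ 2 * Λ ^ 2 * Mw := by
    intro x hx
    rw [Real.norm_eq_abs, abs_mul, abs_of_pos hw0]
    exact gauge_abs_accel_le_of_sup isNearestNeighbourSet_shiftSetFlat (mirrorTable ε ε) hw
      (fun j k => hΦb j k x) hMw (fun j k => hΦg j k x (hsub hx)) i n
  have hd : ∀ x ∈ uIcc τ (τ + h), HasDerivWithinAt
      (fun s => w i n * quadTermOn shiftSetFlat 0 (mirrorTable ε ε) Φ i n s)
      (w i n * linTermOn shiftSetFlat 0 (mirrorTable ε ε) Φ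
        (fun j k s => quadTermOn shiftSetFlat 0 (mirrorTable ε ε) Φ j k s) i n x) (uIcc τ (τ + h)) x :=
    fun x _ => ((hQd x).const_mul _).hasDerivWithinAt
  have hmv := Convex.norm_image_sub_le_of_norm_hasDerivWithin_le hd hb (convex_uIcc τ (τ + h)) left_mem_uIcc
    right_mem_uIcc
  rw [Real.norm_eq_abs, Real.norm_eq_abs, ← mul_sub, abs_mul, abs_of_pos hw0, add_sub_cancel_left] at hmv
  exact hmv

/-- **LANDING AT THE SECTION TIME `τ − h` IN A WINDOW-REGULAR GAUGE, SITE FORM (cure L-56a).** For global solutions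
`X`, `Φ` of `T♭(ε)` with `|X|, |Φ| ≤ M`, gauge bounds `w|X| ≤ M_X`, `w|Φ| ≤ M_w` on `[τ−1, τ+1]` (`w` window-regular,
constant `Λ`), `|h| ≤ 1`, and the landing datum `w_m|X_m(τ) − κΦ_m(τ+h)| ≤ D` on the shells `m ≥ e`: on every shell
`m ≥ e + 1`,
`w_m|X_m(τ−h) − κΦ_m(τ)| ≤ w_m|X_m(τ) − κΦ_m(τ+h)| + 2‖T♭‖₁²M²Λ²(M_X + 2|κ|M_w)h²`
`  + |h|·(|κ||1−κ|‖T♭‖₁MΛM_w + 2‖T♭‖₁|κ|MΛD + ‖T♭‖₁(1+|κ|)MΛD)` —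
the LEADING term is the site's OWN datum (not the uniform `D`), and no admissibility / head gauge is needed, so the
step runs directly in the (shifted) contraction gauge: no conversion constant `C_conv`.
[cite: Tao2016AveragedNS, §4 (4.8), §6.3–6.4 (statement shape: re-centring at a checkpoint); cell harvest/h2-tao-ladder numT56 L-56a (cf. `landing_at_section_time`)] -/
theorem landing_at_section_time_gauge {ε : ℝ} {Φ X : Fin 2 → ℤ → ℝ → ℝ} {w : Fin 2 → ℤ → ℝ}
    {Λ M Mw MX D κ h τ : ℝ} {e : ℤ}
    (hΦ : IsGlobalSol ε Φ) (hX : IsGlobalSol ε X) (hw : IsWindowRegular w Λ)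
    (hΦb : ∀ i n t, |Φ i n t| ≤ M) (hXb : ∀ i n t, |X i n t| ≤ M)
    (hMw : 0 ≤ Mw) (hΦg : ∀ j k, ∀ t ∈ Icc (τ - 1) (τ + 1), w j k * |Φ j k t| ≤ Mw)
    (hMX : 0 ≤ MX) (hXg : ∀ j k, ∀ t ∈ Icc (τ - 1) (τ + 1), w j k * |X j k t| ≤ MX)
    (hh : |h| ≤ 1) (hD0 : 0 ≤ D)
    (hD : ∀ (j : Fin 2) (m : ℤ), e ≤ m → w j m * |X j m τ - κ * Φ j m (τ + h)| ≤ D)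
    (i : Fin 2) (m : ℤ) (hm : e + 1 ≤ m) :
    w i m * |X i m (τ - h) - κ * Φ i m τ|
      ≤ w i m * |X i m τ - κ * Φ i m (τ + h)|
        + 2 * (tableAbsSum shiftSetFlat (mirrorTable ε ε)) ^ 2 * M ^ 2 * Λ ^ 2 * (MX + 2 * |κ| * Mw) * h ^ 2
        + |h| * (|κ| * |1 - κ| * (tableAbsSum shiftSetFlat (mirrorTable ε ε) * M * Λ * Mw)
          + 2 * tableAbsSum shiftSetFlat (mirrorTable ε ε) * (|κ| * M) * Λ * D
          + tableAbsSum shiftSetFlat (mirrorTable ε ε) * ((1 + |κ|) * M) * Λ * D) := by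
  have hw0 : 0 < w i m := hw.1 i m
  have hT0 : 0 ≤ tableAbsSum shiftSetFlat (mirrorTable ε ε) := tableAbsSum_nonneg _ _
  have hM0 : 0 ≤ M := (abs_nonneg _).trans (hΦb 0 0 0)
  have hτh : τ + h ∈ Icc (τ - 1) (τ + 1) := by
    constructor <;> linarith [(abs_le.mp hh).1, (abs_le.mp hh).2]
  -- abbreviations (opaque, with defining equations)
  obtain ⟨Ψf, hΨf⟩ : ∃ Ψf : Fin 2 → ℤ → ℝ → ℝ, Ψf = fun j k s => κ * Φ j k (s + h) := ⟨_, rfl⟩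
  obtain ⟨df, hdf⟩ : ∃ df : Fin 2 → ℤ → ℝ → ℝ, df = fun j k s => X j k s - κ * Φ j k (s + h) := ⟨_, rfl⟩
  have hXsplit : X = Ψf + df := by
    funext j k s; rw [hΨf, hdf]; simp only [Pi.add_apply]; ring
  -- (1) Taylor of X backwards (mixed form)
  have t1 := gauge_abs_taylor_le_of_sup isNearestNeighbourSet_shiftSetFlat (mirrorTable ε ε) hw hMX hX hXb hXg
    (h := -h) (by rwa [abs_neg]) i m
  rw [show τ + -h = τ - h by ring, show (-h) ^ 2 = h ^ 2 by ring] at t1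
  -- (3) Taylor of Φ forwards (mixed form)
  have t3 := gauge_abs_taylor_le_of_sup isNearestNeighbourSet_shiftSetFlat (mirrorTable ε ε) hw hMw hΦ hΦb hΦg hh
    i m
  -- (4a) time-Lipschitz of Q(Φ)
  have t4a := gauge_abs_quadTermOn_sub_time_le_of_sup hΦ hw hΦb hMw hΦg hh i m
  -- (4b) Q(Φ)(τ+h) in the gauge (mixed)
  have t4b : w i m * |quadTermOn shiftSetFlat 0 (mirrorTable ε ε) Φ i m (τ + h)|
      ≤ tableAbsSum shiftSetFlat (mirrorTable ε ε) * M * Λ * Mw :=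
    gauge_abs_quadTermOn_le_of_sup isNearestNeighbourSet_shiftSetFlat (mirrorTable ε ε) hw
      (fun j k => hΦb j k (τ + h)) hMw (fun j k _ => hΦg j k (τ + h) hτh)
  -- (4c) the linear response of the deviation d around Ψ
  have hΨb : ∀ j k, |Ψf j k τ| ≤ |κ| * M := by
    intro j k; rw [hΨf]; simp only [abs_mul]
    exact mul_le_mul_of_nonneg_left (hΦb j k (τ + h)) (abs_nonneg _)
  have hdwin : ∀ j k, m - 1 ≤ k ∧ k ≤ m + 1 → w j k * |df j k τ| ≤ D := by
    intro j k hk; rw [hdf]; exact hD j k (by omega)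
  have t4c : w i m * |linTermOn shiftSetFlat 0 (mirrorTable ε ε) Ψf df i m τ|
      ≤ 2 * tableAbsSum shiftSetFlat (mirrorTable ε ε) * (|κ| * M) * Λ * D :=
    gauge_abs_linTermOn_le_of_sup isNearestNeighbourSet_shiftSetFlat (mirrorTable ε ε) hw hΨb hD0 hdwin
  -- (4d) the quadratic self-term of d (mixed: |d| ≤ (1+|κ|)M)
  have hdb : ∀ j k, |df j k τ| ≤ (1 + |κ|) * M := by
    intro j k; rw [hdf]; simp only
    calc |X j k τ - κ * Φ j k (τ + h)| ≤ |X j k τ| + |κ * Φ j k (τ + h)| := abs_sub _ _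
      _ = |X j k τ| + |κ| * |Φ j k (τ + h)| := by rw [abs_mul]
      _ ≤ M + |κ| * M := add_le_add (hXb j k τ) (mul_le_mul_of_nonneg_left (hΦb j k (τ + h)) (abs_nonneg _))
      _ = (1 + |κ|) * M := by ring
  have t4d : w i m * |quadTermOn shiftSetFlat 0 (mirrorTable ε ε) df i m τ|
      ≤ tableAbsSum shiftSetFlat (mirrorTable ε ε) * ((1 + |κ|) * M) * Λ * D :=
    gauge_abs_quadTermOn_le_of_sup isNearestNeighbourSet_shiftSetFlat (mirrorTable ε ε) hw hdb hD0 hdwin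
  -- Q(X)(τ) = κ² Q(Φ)(τ+h) + Lin_Ψ(d)(τ) + Q(d)(τ)
  have hQΨ : quadTermOn shiftSetFlat 0 (mirrorTable ε ε) Ψf i m τ
      = κ ^ 2 * quadTermOn shiftSetFlat 0 (mirrorTable ε ε) Φ i m (τ + h) := by
    have e1 : Ψf = κ • (fun j k s => Φ j k (s + h)) := by
      funext j k s; rw [hΨf]; simp only [Pi.smul_apply, smul_eq_mul]
    rw [e1, quadTermOn_smul, quadTermOn_timeShift]
  have hQX : quadTermOn shiftSetFlat 0 (mirrorTable ε ε) X i m τ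
      = κ ^ 2 * quadTermOn shiftSetFlat 0 (mirrorTable ε ε) Φ i m (τ + h)
        + linTermOn shiftSetFlat 0 (mirrorTable ε ε) Ψf df i m τ
        + quadTermOn shiftSetFlat 0 (mirrorTable ε ε) df i m τ := by
    rw [hXsplit, quadTermOn_add_eq_lin, hQΨ]
  -- the algebraic decomposition at site (i, m)
  have hdecomp : X i m (τ - h) - κ * Φ i m τ
      = (X i m (τ - h) - X i m τ - (-h) * quadTermOn shiftSetFlat 0 (mirrorTable ε ε) X i m τ)
        + (X i m τ - κ * Φ i m (τ + h))
        + κ * (Φ i m (τ + h) - Φ i m τ - h * quadTermOn shiftSetFlat 0 (mirrorTable ε ε) Φ i m τ)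
        + h * (κ * (quadTermOn shiftSetFlat 0 (mirrorTable ε ε) Φ i m τ
                - quadTermOn shiftSetFlat 0 (mirrorTable ε ε) Φ i m (τ + h))
              + κ * (1 - κ) * quadTermOn shiftSetFlat 0 (mirrorTable ε ε) Φ i m (τ + h)
              - linTermOn shiftSetFlat 0 (mirrorTable ε ε) Ψf df i m τ
              - quadTermOn shiftSetFlat 0 (mirrorTable ε ε) df i m τ) := by
    rw [hQX]; ring
  -- triangle inequality
  have habs : |X i m (τ - h) - κ * Φ i m τ|
      ≤ |X i m (τ - h) - X i m τ - (-h) * quadTermOn shiftSetFlat 0 (mirrorTable ε ε) X i m τ|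
        + |X i m τ - κ * Φ i m (τ + h)|
        + |κ| * |Φ i m (τ + h) - Φ i m τ - h * quadTermOn shiftSetFlat 0 (mirrorTable ε ε) Φ i m τ|
        + |h| * (|κ| * |quadTermOn shiftSetFlat 0 (mirrorTable ε ε) Φ i m τ
                - quadTermOn shiftSetFlat 0 (mirrorTable ε ε) Φ i m (τ + h)|
              + |κ| * |1 - κ| * |quadTermOn shiftSetFlat 0 (mirrorTable ε ε) Φ i m (τ + h)|
              + |linTermOn shiftSetFlat 0 (mirrorTable ε ε) Ψf df i m τ|
              + |quadTermOn shiftSetFlat 0 (mirrorTable ε ε) df i m τ|) := by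
    rw [hdecomp]
    refine (abs_add_le _ _).trans ?_
    refine add_le_add ((abs_add_le _ _).trans (add_le_add ((abs_add_le _ _).trans le_rfl) ?_)) ?_
    · rw [abs_mul]
    · rw [abs_mul]
      refine mul_le_mul_of_nonneg_left ?_ (abs_nonneg _)
      refine (abs_sub _ _).trans (add_le_add ((abs_sub _ _).trans (add_le_add ((abs_add_le _ _).trans
        (add_le_add (by rw [abs_mul]) (by rw [abs_mul, abs_mul]))) le_rfl)) le_rfl)
  -- the time-Lipschitz term read with the arguments swapped
  have t4a' : w i m * |quadTermOn shiftSetFlat 0 (mirrorTable ε ε) Φ i m τ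
        - quadTermOn shiftSetFlat 0 (mirrorTable ε ε) Φ i m (τ + h)|
      ≤ 2 * (tableAbsSum shiftSetFlat (mirrorTable ε ε)) ^ 2 * M ^ 2 * Λ ^ 2 * Mw * |h| := by
    rw [abs_sub_comm]; exact t4a
  -- assemble
  have hκ0 : 0 ≤ |κ| := abs_nonneg _
  have h1κ0 : 0 ≤ |1 - κ| := abs_nonneg _
  have hh0 : 0 ≤ |h| := abs_nonneg _
  have hsq : |h| * |h| = h ^ 2 := by rw [← sq, sq_abs]
  calc w i m * |X i m (τ - h) - κ * Φ i m τ|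
      ≤ w i m * (|X i m (τ - h) - X i m τ - (-h) * quadTermOn shiftSetFlat 0 (mirrorTable ε ε) X i m τ|
        + |X i m τ - κ * Φ i m (τ + h)|
        + |κ| * |Φ i m (τ + h) - Φ i m τ - h * quadTermOn shiftSetFlat 0 (mirrorTable ε ε) Φ i m τ|
        + |h| * (|κ| * |quadTermOn shiftSetFlat 0 (mirrorTable ε ε) Φ i m τ
                - quadTermOn shiftSetFlat 0 (mirrorTable ε ε) Φ i m (τ + h)|
              + |κ| * |1 - κ| * |quadTermOn shiftSetFlat 0 (mirrorTable ε ε) Φ i m (τ + h)|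
              + |linTermOn shiftSetFlat 0 (mirrorTable ε ε) Ψf df i m τ|
              + |quadTermOn shiftSetFlat 0 (mirrorTable ε ε) df i m τ|)) :=
        mul_le_mul_of_nonneg_left habs hw0.le
    _ = w i m * |X i m (τ - h) - X i m τ - (-h) * quadTermOn shiftSetFlat 0 (mirrorTable ε ε) X i m τ|
        + w i m * |X i m τ - κ * Φ i m (τ + h)|
        + |κ| * (w i m *
            |Φ i m (τ + h) - Φ i m τ - h * quadTermOn shiftSetFlat 0 (mirrorTable ε ε) Φ i m τ|)
        + |h| * (|κ| * (w i m * |quadTermOn shiftSetFlat 0 (mirrorTable ε ε) Φ i m τ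
                - quadTermOn shiftSetFlat 0 (mirrorTable ε ε) Φ i m (τ + h)|)
              + |κ| * |1 - κ| * (w i m * |quadTermOn shiftSetFlat 0 (mirrorTable ε ε) Φ i m (τ + h)|)
              + w i m * |linTermOn shiftSetFlat 0 (mirrorTable ε ε) Ψf df i m τ|
              + w i m * |quadTermOn shiftSetFlat 0 (mirrorTable ε ε) df i m τ|) := by ring
    _ ≤ 2 * (tableAbsSum shiftSetFlat (mirrorTable ε ε)) ^ 2 * M ^ 2 * Λ ^ 2 * MX * h ^ 2
        + w i m * |X i m τ - κ * Φ i m (τ + h)|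
        + |κ| * (2 * (tableAbsSum shiftSetFlat (mirrorTable ε ε)) ^ 2 * M ^ 2 * Λ ^ 2 * Mw * h ^ 2)
        + |h| * (|κ| * (2 * (tableAbsSum shiftSetFlat (mirrorTable ε ε)) ^ 2 * M ^ 2 * Λ ^ 2 * Mw * |h|)
              + |κ| * |1 - κ| * (tableAbsSum shiftSetFlat (mirrorTable ε ε) * M * Λ * Mw)
              + 2 * tableAbsSum shiftSetFlat (mirrorTable ε ε) * (|κ| * M) * Λ * D
              + tableAbsSum shiftSetFlat (mirrorTable ε ε) * ((1 + |κ|) * M) * Λ * D) := by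
        gcongr
    _ = w i m * |X i m τ - κ * Φ i m (τ + h)|
        + 2 * (tableAbsSum shiftSetFlat (mirrorTable ε ε)) ^ 2 * M ^ 2 * Λ ^ 2 * (MX + 2 * |κ| * Mw) * h ^ 2
        + |h| * (|κ| * |1 - κ| * (tableAbsSum shiftSetFlat (mirrorTable ε ε) * M * Λ * Mw)
          + 2 * tableAbsSum shiftSetFlat (mirrorTable ε ε) * (|κ| * M) * Λ * D
          + tableAbsSum shiftSetFlat (mirrorTable ε ε) * ((1 + |κ|) * M) * Λ * D) := by
        rw [← hsq]; ring

end MirrorPulse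

end Summit.NavierStokesRegularity.NavierStokesRegularity.Theorems

end
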